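import Literature.MathematicalPhysics.QuantumFieldTheory.Balaban1983to89.B4Sect5L2

/-!
# `BalabanUV.Beta.FP.WellConditionedInverseLocalityZd` — road «FP» for binder row D1, row **WCI** (R-FP-24) ON THE INFINITE LATTICE `ℤ^D`:
# A WELL-CONDITIONED, EXPONENTIALLY LOCALISED KERNEL HAS AN EXPONENTIALLY LOCALISED INVERSE —
# `0 ⪯ K`, `|K(p,q)| ≤ C·e^{−δ·dist(p,q)}` ⟹ `|(𝟙 + K)⁻¹(p,q)| ≤ c⋆·e^{−δ⋆·dist(p,q)}` with EXPLICIT `c⋆ = cStar D N 1 (1+C) δ`,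
# `δ⋆ = deltaStar D N 1 (1+C) δ` (pv23's B4 Sect. 5 constants), for matrix-valued kernels on `ℤ^D × Fin N` — the COMPLEMENT of
# t4-ne9-formalise-leaf-04's finite-index-set ∕ torus file `FP/WellConditionedInverseLocality` (`B4Sect5Torus.inv_decay`)

NOT IN PRINT as a road statement; [folklore] PACKAGING of pv23's kernel theorems `Literature…B4Sect5Exhaustion` (the Sect. 5 Theorem of [B4]
= Bałaban, *Regularity and decay of lattice Green's functions*, CMP 89 (1983), p. 594, kernel-proved for an ARBITRARY `Ω ⊂ ℤ^d`, Dirichlet-exhaustion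
inverse `limInv`) and `Literature…B4Sect5L2` (the same in `ℓ²`-OPERATOR currency, inverse kernel `G` by Lax–Milgram + Schur) AT `A := 𝟙 + K`, `γ₀ := 1`,
`c₀ := 1 + C`, `δ₀ := δ`, `Ω := univ`.  No new analysis: this file DISCHARGES the coercivity field of `Hyp56Z` from «`0 ⪯ K` + identity» (resp. from a
displayed coercivity constant) and pins the row's displayed shape BY NAME, so that organisation β's consumers on the INFINITE coarse lattice
(`(QG_aQᵀ)⁻¹`, `(1 + QG₁Qᵀ)⁻¹` on `ℓ²(ℤ⁴ × Fin 4)` — no volume cut-off in the unit-lattice perfect theory) have an object (`limInv univ (𝟙 + K)`,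
resp. `B4Sect5L2.G`) and its decay with explicit constants; the hypothesis «`‖K‖ ≤ C`» of the row is NOT needed (Schur's test from the decay).

HONEST FRAMING (cell contract, verbatim): «discharging `BetaPertH` makes Bałaban's UV stability UNCONDITIONAL — a real constructive-QFT result; it is
NOT the continuum limit and NOT the Clay problem.»  HONEST DEPENDENCY (verbatim): «continuum YM on T⁴ ⇐ BetaPertH ∧ nine spine estimates (0/9 proved);
BetaPertH ⇐ (D1) ∧ (D4) ∧ CAP+tail; G-an2-4 gates asym, D1 and NE2/3/4.»  THIS MODULE discharges NOTHING of IR-I ∕ hT ∕ `hasym` ∕ row D1; 0 `def`,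
0 `def … : Prop`, nothing cited as a hypothesis (the `[cite:]` tags live in pv23's modules), 0 sorry; NEVER «G-an2-4 closed», NOT (CONV-C), NOT D1, NOT
BetaPertH, NOT continuum, NOT Clay.
ABSOLUTE RULE (cell charter, verbatim): «No internally-minted statement may enter as a cited fact. Every hypothesis is either kernel-proved in this
package or a verbatim quotation of a PUBLISHED theorem with page reference. The manuscript(s) under audit are NOT citable for their own disputed steps
— they are the thing under adjudication; programme-internal (2001/route/tribunal) claims are never citable.»

CONTENT (`{D N : ℕ}`; kernels `T : K D N → K D N → ℝ` on `K D N = (Fin D → ℤ) × Fin N`; `dist` = Mathlib's sup distance on `Fin D → ℤ`;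
the identity kernel is written inline as `fun p q => if p = q then 1 else 0`):
* §1 [folklore] `toMat_one_add`, **`hyp56Z_of_coercive`** (γ-coercive finite compressions + symmetry + decay ⟹ `Hyp56Z univ A γ c₀ δ₀` — the general
  shape, for `(QG_aQᵀ)⁻¹`-type inverses), **`hyp56Z_one_add`** (`0 ⪯ K` ⟹ `Hyp56Z univ (𝟙 + K) 1 (1 + C) δ`), **`hyp56Z_smul_one_add`** (mass `m > 0`:
  `Hyp56Z univ (m•𝟙 + K) m (m + C) δ`).
* §2 THE ENDS for `𝟙 + K` (every hypothesis displayed): **`abs_limInv_one_add_le`** (`|limInv univ (𝟙+K) p q| ≤ cStar D N 1 (1+C) δ · e^{−deltaStar D N 1 (1+C) δ · dist}`),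
  `tsum_one_add_mul_limInv` ∕ `tsum_limInv_mul_one_add` (two-sided inverse identities, `= if p = r then 1 else 0`), **`eq_limInv_one_add_of_left_inverse`** ∕
  `…_of_right_inverse` (ANY bounded one-sided inverse kernel IS `limInv` — the hook by which a consumer's own inverse inherits the decay),
  **`abs_leftInverse_one_add_le`** (corollary: a bounded left inverse decays), the `ℓ²` reading **`abs_G_one_add_le`** (`B4Sect5L2.G` of `opA univ (𝟙 + K)`),
  and `cStar_one_add_pos` ∕ `deltaStar_one_add_pos`.
* §3 the mass twins `abs_limInv_smul_one_add_le`, `abs_leftInverse_smul_one_add_le` (`m•𝟙 + K`, constants `cStar D N m (m+C) δ`, `deltaStar D N m (m+C) δ`).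
Unit `b2b-balaban-gan24-p3` (gen 19; binder row G-an2-4 part P3 lineage = road-FP K-side supplier), 2026-08-20.
-/

noncomputable section

open Finset Filter Topology
open scoped BigOperators
open Literature.MathematicalPhysics.QuantumFieldTheory.Balaban1983to89
open B4Sect5Proof (cStar deltaStar cStar_pos deltaStar_pos)
open B4Sect5Exhaustion (K toMat Hyp56Z limInv limInv_abs_le tendsto_limInv tsum_mul_limInv tsum_limInv_mul summable_mul_limInv
  summable_limInv_mul eq_limInv_of_left_inverse eq_limInv_of_right_inverse limInv_symm)
open B4Sect5L2 (idx G abs_G_le_exp G_eq_limInv)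

namespace Summit.QuantumFields.BalabanUV.Beta.FP.WellConditionedInverseLocalityZd

variable {D N : ℕ}

/-! ## §1 The hypothesis (5.6) for `𝟙 + K`, `m•𝟙 + K` and for a displayed coercivity constant -/

/-- [folklore] Compression of the identity kernel is the identity matrix. -/
theorem toMat_kronecker (Λ : Finset (Fin D → ℤ)) :
    toMat Λ (fun p q : K D N => if p = q then (1 : ℝ) else 0) = 1 := by
  classical
  ext a b
  simp only [toMat, Matrix.one_apply]
  by_cases hab : a = b
  · subst hab; simp
  · have : ((a.1 : Fin D → ℤ), a.2) ≠ ((b.1 : Fin D → ℤ), b.2) := by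
      intro h
      apply hab
      exact Prod.ext (Subtype.ext (Prod.ext_iff.1 h).1) (Prod.ext_iff.1 h).2
    rw [if_neg this, if_neg hab]

/-- [folklore] Compression is additive and commutes with real scalars: `toMat Λ (m•𝟙 + T) = m•1 + toMat Λ T`. -/
theorem toMat_smul_one_add (Λ : Finset (Fin D → ℤ)) (m : ℝ) (T : K D N → K D N → ℝ) :
    toMat Λ (fun p q : K D N => m * (if p = q then (1 : ℝ) else 0) + T p q) = m • (1 : Matrix (B4.Idx Λ N) (B4.Idx Λ N) ℝ) + toMat Λ T := by
  rw [← toMat_kronecker Λ]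
  ext a b
  simp only [toMat, Matrix.add_apply, Matrix.smul_apply, smul_eq_mul]

/-- [folklore] `toMat Λ (𝟙 + T) = 1 + toMat Λ T`. -/
theorem toMat_one_add (Λ : Finset (Fin D → ℤ)) (T : K D N → K D N → ℝ) :
    toMat Λ (fun p q : K D N => (if p = q then (1 : ℝ) else 0) + T p q) = 1 + toMat Λ T := by
  have h := toMat_smul_one_add Λ 1 T
  simp only [one_mul, one_smul] at h
  exact h

/-- [folklore] **THE GENERAL SHAPE**: a symmetric kernel on `ℤ^D × Fin N` whose every finite compression is `γ`-coercive and whose entries decay like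
`c₀·e^{−δ₀·dist}` satisfies pv23's (5.6) on `Ω = univ` — the input of `B4Sect5Exhaustion.limInv_abs_le` (for `(QG_aQᵀ)⁻¹`-type inverses, whose
coercivity constant is displayed rather than coming from `𝟙 + PSD`). -/
theorem hyp56Z_of_coercive {A : K D N → K D N → ℝ} {γ c₀ δ₀ : ℝ} (hsymm : ∀ p q, A p q = A q p)
    (hco : ∀ (Λ : Finset (Fin D → ℤ)) (v : B4.Idx Λ N → ℝ), γ * ∑ p, v p ^ 2 ≤ ∑ p, v p * (toMat Λ A).mulVec v p)
    (hdec : ∀ p q, |A p q| ≤ c₀ * Real.exp (-(δ₀ * dist p.1 q.1))) :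
    Hyp56Z (Set.univ : Set (Fin D → ℤ)) A γ c₀ δ₀ :=
  ⟨fun p q _ _ => hsymm p q, fun Λ _ v => hco Λ v, fun p q _ _ => hdec p q⟩

/-- [folklore] **(5.6) FOR `m•𝟙 + K` WITH `0 ⪯ K`** (mass `m > 0`): symmetry of `K`, nonnegativity of every finite compression's quadratic form and the
decay `|K p q| ≤ C·e^{−δ·dist}` give `Hyp56Z univ (m•𝟙 + K) m (m + C) δ`. -/
theorem hyp56Z_smul_one_add {T : K D N → K D N → ℝ} {m C δ : ℝ} (hm : 0 < m) (hT : ∀ p q, T p q = T q p)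
    (hT0 : ∀ (Λ : Finset (Fin D → ℤ)) (v : B4.Idx Λ N → ℝ), 0 ≤ ∑ p, v p * (toMat Λ T).mulVec v p)
    (hdec : ∀ p q, |T p q| ≤ C * Real.exp (-(δ * dist p.1 q.1))) :
    Hyp56Z (Set.univ : Set (Fin D → ℤ)) (fun p q : K D N => m * (if p = q then (1 : ℝ) else 0) + T p q) m (m + C) δ := by
  classical
  refine hyp56Z_of_coercive (fun p q => ?_) (fun Λ v => ?_) (fun p q => ?_)
  · -- symmetry
    by_cases h : p = q
    · subst h; rfl
    · rw [if_neg h, if_neg (Ne.symm h), hT p q]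
  · -- coercivity: `Σ v·((m•1 + T_Λ)v) = m Σ v² + Σ v·(T_Λ v) ≥ m Σ v²`
    rw [toMat_smul_one_add, Matrix.add_mulVec, Matrix.smul_mulVec, Matrix.one_mulVec]
    have hsplit : ∑ p, v p * (m • v + (toMat Λ T).mulVec v) p = m * ∑ p, v p ^ 2 + ∑ p, v p * (toMat Λ T).mulVec v p := by
      rw [Finset.mul_sum, ← Finset.sum_add_distrib]
      refine Finset.sum_congr rfl fun p _ => ?_
      simp only [Pi.add_apply, Pi.smul_apply, smul_eq_mul]
      ring
    rw [hsplit]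
    linarith [hT0 Λ v]
  · -- decay with constant `m + C`
    have hexp : 0 < Real.exp (-(δ * dist p.1 q.1)) := Real.exp_pos _
    by_cases h : p = q
    · subst h
      simp only [if_true, mul_one, dist_self, mul_zero, neg_zero, Real.exp_zero]
      have h1 := hdec p p
      rw [dist_self, mul_zero, neg_zero, Real.exp_zero, mul_one] at h1
      calc |m + T p p| ≤ |m| + |T p p| := abs_add_le _ _
        _ ≤ m + C := by rw [abs_of_pos hm]; linarith
    · rw [if_neg h, mul_zero, zero_add]
      calc |T p q| ≤ C * Real.exp (-(δ * dist p.1 q.1)) := hdec p q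
        _ ≤ (m + C) * Real.exp (-(δ * dist p.1 q.1)) := by
            refine mul_le_mul_of_nonneg_right (by linarith) hexp.le

/-- [folklore] **(5.6) FOR `𝟙 + K` WITH `0 ⪯ K`**: `Hyp56Z univ (𝟙 + K) 1 (1 + C) δ`. -/
theorem hyp56Z_one_add {T : K D N → K D N → ℝ} {C δ : ℝ} (hT : ∀ p q, T p q = T q p)
    (hT0 : ∀ (Λ : Finset (Fin D → ℤ)) (v : B4.Idx Λ N → ℝ), 0 ≤ ∑ p, v p * (toMat Λ T).mulVec v p)
    (hdec : ∀ p q, |T p q| ≤ C * Real.exp (-(δ * dist p.1 q.1))) :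
    Hyp56Z (Set.univ : Set (Fin D → ℤ)) (fun p q : K D N => (if p = q then (1 : ℝ) else 0) + T p q) 1 (1 + C) δ := by
  have h := hyp56Z_smul_one_add (m := 1) one_pos hT hT0 hdec
  simp only [one_mul] at h
  exact h

/-! ## §2 The ends for `𝟙 + K` -/

section OneAdd

variable {T : K D N → K D N → ℝ} {C δ : ℝ}

/-- [folklore] The constants are positive: `0 < cStar D N 1 (1 + C) δ`. -/
theorem cStar_one_add_pos (D N : ℕ) (C δ : ℝ) : 0 < cStar D N 1 (1 + C) δ := cStar_pos D N (1 + C) δ one_pos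

/-- [folklore] `0 < deltaStar D N 1 (1 + C) δ` for `0 ≤ C`, `0 < δ`. -/
theorem deltaStar_one_add_pos (D N : ℕ) {C δ : ℝ} (hC : 0 ≤ C) (hδ : 0 < δ) : 0 < deltaStar D N 1 (1 + C) δ :=
  deltaStar_pos D N one_pos (by linarith) hδ

/-- [our object] **WCI ON `ℤ^D`, KERNEL CURRENCY**: for a symmetric kernel `K` on `ℤ^D × Fin N` with form-nonnegative finite compressions and
`|K p q| ≤ C·e^{−δ·dist(p,q)}` (`0 ≤ C`, `0 < δ`), the Dirichlet-exhaustion inverse kernel of `𝟙 + K` decays: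
`|limInv univ (𝟙 + K) p q| ≤ cStar D N 1 (1+C) δ · e^{−deltaStar D N 1 (1+C) δ · dist(p,q)}` (pv23's `B4Sect5Exhaustion.limInv_abs_le`). -/
theorem abs_limInv_one_add_le (hT : ∀ p q, T p q = T q p)
    (hT0 : ∀ (Λ : Finset (Fin D → ℤ)) (v : B4.Idx Λ N → ℝ), 0 ≤ ∑ p, v p * (toMat Λ T).mulVec v p)
    (hC : 0 ≤ C) (hδ : 0 < δ) (hdec : ∀ p q, |T p q| ≤ C * Real.exp (-(δ * dist p.1 q.1))) (p q : K D N) :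
    |limInv (Set.univ : Set (Fin D → ℤ)) (fun p q : K D N => (if p = q then (1 : ℝ) else 0) + T p q) p q|
      ≤ cStar D N 1 (1 + C) δ * Real.exp (-(deltaStar D N 1 (1 + C) δ * dist p.1 q.1)) :=
  limInv_abs_le one_pos (by linarith) hδ (hyp56Z_one_add hT hT0 hdec) p q

/-- [our object] `limInv univ (𝟙 + K)` is a RIGHT inverse: `Σ' q, (𝟙 + K)(p,q)·limInv(q,r) = [p = r]`, absolutely convergent. -/
theorem tsum_one_add_mul_limInv (hT : ∀ p q, T p q = T q p)
    (hT0 : ∀ (Λ : Finset (Fin D → ℤ)) (v : B4.Idx Λ N → ℝ), 0 ≤ ∑ p, v p * (toMat Λ T).mulVec v p)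
    (hC : 0 ≤ C) (hδ : 0 < δ) (hdec : ∀ p q, |T p q| ≤ C * Real.exp (-(δ * dist p.1 q.1))) (p r : K D N) :
    ∑' q, ((if p = q then (1 : ℝ) else 0) + T p q) *
        limInv (Set.univ : Set (Fin D → ℤ)) (fun p q : K D N => (if p = q then (1 : ℝ) else 0) + T p q) q r
      = if p = r then 1 else 0 :=
  tsum_mul_limInv one_pos (by linarith) hδ (hyp56Z_one_add hT hT0 hdec) (Set.mem_univ _) (Set.mem_univ _)

/-- [our object] … and a LEFT inverse: `Σ' q, limInv(p,q)·(𝟙 + K)(q,r) = [p = r]`. -/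
theorem tsum_limInv_mul_one_add (hT : ∀ p q, T p q = T q p)
    (hT0 : ∀ (Λ : Finset (Fin D → ℤ)) (v : B4.Idx Λ N → ℝ), 0 ≤ ∑ p, v p * (toMat Λ T).mulVec v p)
    (hC : 0 ≤ C) (hδ : 0 < δ) (hdec : ∀ p q, |T p q| ≤ C * Real.exp (-(δ * dist p.1 q.1))) (p r : K D N) :
    ∑' q, limInv (Set.univ : Set (Fin D → ℤ)) (fun p q : K D N => (if p = q then (1 : ℝ) else 0) + T p q) p q *
        ((if q = r then (1 : ℝ) else 0) + T q r)
      = if p = r then 1 else 0 :=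
  tsum_limInv_mul one_pos (by linarith) hδ (hyp56Z_one_add hT hT0 hdec) (Set.mem_univ _) (Set.mem_univ _)

/-- [our object] Summability of the right-inverse product. -/
theorem summable_one_add_mul_limInv (hT : ∀ p q, T p q = T q p)
    (hT0 : ∀ (Λ : Finset (Fin D → ℤ)) (v : B4.Idx Λ N → ℝ), 0 ≤ ∑ p, v p * (toMat Λ T).mulVec v p)
    (hC : 0 ≤ C) (hδ : 0 < δ) (hdec : ∀ p q, |T p q| ≤ C * Real.exp (-(δ * dist p.1 q.1))) (p r : K D N) :
    Summable (fun q => ((if p = q then (1 : ℝ) else 0) + T p q) *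
        limInv (Set.univ : Set (Fin D → ℤ)) (fun p q : K D N => (if p = q then (1 : ℝ) else 0) + T p q) q r) :=
  summable_mul_limInv one_pos (by linarith) hδ (hyp56Z_one_add hT hT0 hdec) (Set.mem_univ p) r

/-- [our object] Summability of the left-inverse product. -/
theorem summable_limInv_mul_one_add (hT : ∀ p q, T p q = T q p)
    (hT0 : ∀ (Λ : Finset (Fin D → ℤ)) (v : B4.Idx Λ N → ℝ), 0 ≤ ∑ p, v p * (toMat Λ T).mulVec v p)
    (hC : 0 ≤ C) (hδ : 0 < δ) (hdec : ∀ p q, |T p q| ≤ C * Real.exp (-(δ * dist p.1 q.1))) (p r : K D N) :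
    Summable (fun q => limInv (Set.univ : Set (Fin D → ℤ)) (fun p q : K D N => (if p = q then (1 : ℝ) else 0) + T p q) p q *
        ((if q = r then (1 : ℝ) else 0) + T q r)) :=
  summable_limInv_mul one_pos (by linarith) hδ (hyp56Z_one_add hT hT0 hdec) p (Set.mem_univ r)

/-- [our object] **UNIQUENESS — THE CONSUMER's HOOK**: ANY entrywise-bounded kernel `E` that is a LEFT inverse of `𝟙 + K` (`Σ' q, E(p,q)(𝟙+K)(q,r) = [p = r]`)
IS `limInv univ (𝟙 + K)` (pv23's `eq_limInv_of_left_inverse`); so a Neumann-series or `ℓ²`-theoretic inverse inherits the decay of `abs_limInv_one_add_le`. -/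
theorem eq_limInv_one_add_of_left_inverse (hT : ∀ p q, T p q = T q p)
    (hT0 : ∀ (Λ : Finset (Fin D → ℤ)) (v : B4.Idx Λ N → ℝ), 0 ≤ ∑ p, v p * (toMat Λ T).mulVec v p)
    (hC : 0 ≤ C) (hδ : 0 < δ) (hdec : ∀ p q, |T p q| ≤ C * Real.exp (-(δ * dist p.1 q.1)))
    {E : K D N → K D N → ℝ} {M : ℝ} (hEM : ∀ p q, |E p q| ≤ M)
    (hE : ∀ p r : K D N, ∑' q, E p q * ((if q = r then (1 : ℝ) else 0) + T q r) = if p = r then 1 else 0) (p s : K D N) :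
    E p s = limInv (Set.univ : Set (Fin D → ℤ)) (fun p q : K D N => (if p = q then (1 : ℝ) else 0) + T p q) p s :=
  eq_limInv_of_left_inverse one_pos (by linarith) hδ (hyp56Z_one_add hT hT0 hdec) hEM
    (fun _ _ hq => absurd (Set.mem_univ _) hq) (fun p r _ _ => hE p r) (Set.mem_univ _) (Set.mem_univ _)

/-- [our object] The RIGHT-inverse twin of the uniqueness. -/
theorem eq_limInv_one_add_of_right_inverse (hT : ∀ p q, T p q = T q p)
    (hT0 : ∀ (Λ : Finset (Fin D → ℤ)) (v : B4.Idx Λ N → ℝ), 0 ≤ ∑ p, v p * (toMat Λ T).mulVec v p)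
    (hC : 0 ≤ C) (hδ : 0 < δ) (hdec : ∀ p q, |T p q| ≤ C * Real.exp (-(δ * dist p.1 q.1)))
    {E : K D N → K D N → ℝ} {M : ℝ} (hEM : ∀ p q, |E p q| ≤ M)
    (hE : ∀ p r : K D N, ∑' q, ((if p = q then (1 : ℝ) else 0) + T p q) * E q r = if p = r then 1 else 0) (p s : K D N) :
    E p s = limInv (Set.univ : Set (Fin D → ℤ)) (fun p q : K D N => (if p = q then (1 : ℝ) else 0) + T p q) p s :=
  eq_limInv_of_right_inverse one_pos (by linarith) hδ (hyp56Z_one_add hT hT0 hdec) hEM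
    (fun _ _ hp => absurd (Set.mem_univ _) hp) (fun p r _ _ => hE p r) (Set.mem_univ _) (Set.mem_univ _)

/-- [our object] **THE ROW's SHAPE FOR A CONSUMER's OWN INVERSE**: a bounded left inverse `E` of `𝟙 + K` satisfies
`|E p q| ≤ cStar D N 1 (1+C) δ · e^{−deltaStar D N 1 (1+C) δ · dist(p,q)}`. -/
theorem abs_leftInverse_one_add_le (hT : ∀ p q, T p q = T q p)
    (hT0 : ∀ (Λ : Finset (Fin D → ℤ)) (v : B4.Idx Λ N → ℝ), 0 ≤ ∑ p, v p * (toMat Λ T).mulVec v p)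
    (hC : 0 ≤ C) (hδ : 0 < δ) (hdec : ∀ p q, |T p q| ≤ C * Real.exp (-(δ * dist p.1 q.1)))
    {E : K D N → K D N → ℝ} {M : ℝ} (hEM : ∀ p q, |E p q| ≤ M)
    (hE : ∀ p r : K D N, ∑' q, E p q * ((if q = r then (1 : ℝ) else 0) + T q r) = if p = r then 1 else 0) (p q : K D N) :
    |E p q| ≤ cStar D N 1 (1 + C) δ * Real.exp (-(deltaStar D N 1 (1 + C) δ * dist p.1 q.1)) := by
  rw [eq_limInv_one_add_of_left_inverse hT hT0 hC hδ hdec hEM hE p q]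
  exact abs_limInv_one_add_le hT hT0 hC hδ hdec p q

/-- [our object] Symmetry of the inverse kernel. -/
theorem limInv_one_add_symm (hT : ∀ p q, T p q = T q p)
    (hT0 : ∀ (Λ : Finset (Fin D → ℤ)) (v : B4.Idx Λ N → ℝ), 0 ≤ ∑ p, v p * (toMat Λ T).mulVec v p)
    (hC : 0 ≤ C) (hδ : 0 < δ) (hdec : ∀ p q, |T p q| ≤ C * Real.exp (-(δ * dist p.1 q.1))) (p q : K D N) :
    limInv (Set.univ : Set (Fin D → ℤ)) (fun p q : K D N => (if p = q then (1 : ℝ) else 0) + T p q) p q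
      = limInv (Set.univ : Set (Fin D → ℤ)) (fun p q : K D N => (if p = q then (1 : ℝ) else 0) + T p q) q p :=
  limInv_symm one_pos (by linarith) hδ (hyp56Z_one_add hT hT0 hdec) p q

/-- [our object] **WCI ON `ℤ^D`, `ℓ²`-OPERATOR CURRENCY**: the kernel `G` of the inverse of the bounded, coercive operator `opA univ (𝟙 + K)` on
`l²(ℤ^D × Fin N)` (pv23's `B4Sect5L2`, Lax–Milgram + Schur) decays with the same constants; and `G = limInv` entrywise (`B4Sect5L2.G_eq_limInv`). -/
theorem abs_G_one_add_le (hT : ∀ p q, T p q = T q p)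
    (hT0 : ∀ (Λ : Finset (Fin D → ℤ)) (v : B4.Idx Λ N → ℝ), 0 ≤ ∑ p, v p * (toMat Λ T).mulVec v p)
    (hC : 0 ≤ C) (hδ : 0 < δ) (hdec : ∀ p q, |T p q| ≤ C * Real.exp (-(δ * dist p.1 q.1)))
    (p q : idx N (Set.univ : Set (Fin D → ℤ))) :
    |G (hyp56Z_one_add hT hT0 hdec) one_pos (by linarith : (0 : ℝ) ≤ 1 + C) hδ p q|
      ≤ cStar D N 1 (1 + C) δ * Real.exp (-(deltaStar D N 1 (1 + C) δ * dist p.1.1 q.1.1)) :=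
  abs_G_le_exp (hyp56Z_one_add hT hT0 hdec) one_pos (by linarith) hδ p q

end OneAdd

/-! ## §3 The mass twins for `m•𝟙 + K` -/

section Mass

variable {T : K D N → K D N → ℝ} {m C δ : ℝ}

/-- [our object] **WCI WITH A MASS**: `|limInv univ (m•𝟙 + K) p q| ≤ cStar D N m (m+C) δ · e^{−deltaStar D N m (m+C) δ · dist(p,q)}` (`0 < m`). -/
theorem abs_limInv_smul_one_add_le (hm : 0 < m) (hT : ∀ p q, T p q = T q p)
    (hT0 : ∀ (Λ : Finset (Fin D → ℤ)) (v : B4.Idx Λ N → ℝ), 0 ≤ ∑ p, v p * (toMat Λ T).mulVec v p)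
    (hC : 0 ≤ C) (hδ : 0 < δ) (hdec : ∀ p q, |T p q| ≤ C * Real.exp (-(δ * dist p.1 q.1))) (p q : K D N) :
    |limInv (Set.univ : Set (Fin D → ℤ)) (fun p q : K D N => m * (if p = q then (1 : ℝ) else 0) + T p q) p q|
      ≤ cStar D N m (m + C) δ * Real.exp (-(deltaStar D N m (m + C) δ * dist p.1 q.1)) :=
  limInv_abs_le hm (by linarith) hδ (hyp56Z_smul_one_add hm hT hT0 hdec) p q

/-- [our object] A bounded left inverse of `m•𝟙 + K` decays with the mass-`m` constants. -/
theorem abs_leftInverse_smul_one_add_le (hm : 0 < m) (hT : ∀ p q, T p q = T q p)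
    (hT0 : ∀ (Λ : Finset (Fin D → ℤ)) (v : B4.Idx Λ N → ℝ), 0 ≤ ∑ p, v p * (toMat Λ T).mulVec v p)
    (hC : 0 ≤ C) (hδ : 0 < δ) (hdec : ∀ p q, |T p q| ≤ C * Real.exp (-(δ * dist p.1 q.1)))
    {E : K D N → K D N → ℝ} {M : ℝ} (hEM : ∀ p q, |E p q| ≤ M)
    (hE : ∀ p r : K D N, ∑' q, E p q * (m * (if q = r then (1 : ℝ) else 0) + T q r) = if p = r then 1 else 0) (p q : K D N) :
    |E p q| ≤ cStar D N m (m + C) δ * Real.exp (-(deltaStar D N m (m + C) δ * dist p.1 q.1)) := by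
  have hA := hyp56Z_smul_one_add hm hT hT0 hdec
  rw [eq_limInv_of_left_inverse hm (by linarith) hδ hA hEM (fun _ _ hq => absurd (Set.mem_univ _) hq)
    (fun p r _ _ => hE p r) (Set.mem_univ _) (Set.mem_univ _)]
  exact limInv_abs_le hm (by linarith) hδ hA p q

/-- [our object] **THE GENERAL COERCIVE SHAPE AT THE END** (for `(QG_aQᵀ)⁻¹`-type inverses): symmetric `A`, `γ`-coercive compressions, decay
`c₀·e^{−δ₀·dist}` ⟹ `|limInv univ A p q| ≤ cStar D N γ c₀ δ₀ · e^{−deltaStar D N γ c₀ δ₀ · dist}` and every bounded left inverse of `A` equals it. -/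
theorem abs_limInv_le_of_coercive {A : K D N → K D N → ℝ} {γ c₀ δ₀ : ℝ} (hγ : 0 < γ) (hc : 0 < c₀) (hδ : 0 < δ₀)
    (hsymm : ∀ p q, A p q = A q p)
    (hco : ∀ (Λ : Finset (Fin D → ℤ)) (v : B4.Idx Λ N → ℝ), γ * ∑ p, v p ^ 2 ≤ ∑ p, v p * (toMat Λ A).mulVec v p)
    (hdec : ∀ p q, |A p q| ≤ c₀ * Real.exp (-(δ₀ * dist p.1 q.1))) (p q : K D N) :
    |limInv (Set.univ : Set (Fin D → ℤ)) A p q| ≤ cStar D N γ c₀ δ₀ * Real.exp (-(deltaStar D N γ c₀ δ₀ * dist p.1 q.1)) :=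
  limInv_abs_le hγ hc hδ (hyp56Z_of_coercive hsymm hco hdec) p q

/-- [our object] … and the bounded-left-inverse form of the general shape. -/
theorem abs_leftInverse_le_of_coercive {A : K D N → K D N → ℝ} {γ c₀ δ₀ : ℝ} (hγ : 0 < γ) (hc : 0 < c₀) (hδ : 0 < δ₀)
    (hsymm : ∀ p q, A p q = A q p)
    (hco : ∀ (Λ : Finset (Fin D → ℤ)) (v : B4.Idx Λ N → ℝ), γ * ∑ p, v p ^ 2 ≤ ∑ p, v p * (toMat Λ A).mulVec v p)
    (hdec : ∀ p q, |A p q| ≤ c₀ * Real.exp (-(δ₀ * dist p.1 q.1)))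
    {E : K D N → K D N → ℝ} {M : ℝ} (hEM : ∀ p q, |E p q| ≤ M)
    (hE : ∀ p r : K D N, ∑' q, E p q * A q r = if p = r then 1 else 0) (p q : K D N) :
    |E p q| ≤ cStar D N γ c₀ δ₀ * Real.exp (-(deltaStar D N γ c₀ δ₀ * dist p.1 q.1)) := by
  have hA := hyp56Z_of_coercive (N := N) hsymm hco hdec
  rw [eq_limInv_of_left_inverse hγ hc hδ hA hEM (fun _ _ hq => absurd (Set.mem_univ _) hq)
    (fun p r _ _ => hE p r) (Set.mem_univ _) (Set.mem_univ _)]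
  exact limInv_abs_le hγ hc hδ hA p q

end Mass

end Summit.QuantumFields.BalabanUV.Beta.FP.WellConditionedInverseLocalityZd

end
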